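import Summits.Ventures.HSemireg.WedgeHankelRecurrenceBezoutianRemainderSequence
import Literature.Algebra.Polynomial.TarskiQuery

/-!
# Venture HSemireg — BPR THEOREM 9.4 (2) OVER `ℝ`: **`Sign Bez(P, Q) = Ind(Q/P)`** for every real `P ≠ 0` and `Q` with `deg Q < deg P` — the odd-degree-drop sum of N149 is the number of sign variations of the
# signed remainder sequence LOST between `−∞` and `+∞`, which by the tree's Theorem 2.58 (`Var(SRemS(P,Q); a, b) = Ind(Q/P; a, b)`) is the Cauchy index: for every window `(lo, hi)` containing the
# real roots of `P`, `sigPos B(Q,P) − sigNeg B(Q,P) = cauchyIndex P Q lo hi` (Hermite 1856 – Hurwitz 1895 – Kronecker 1881, BPR 2006 Thm. 9.4, here with multiple roots allowed)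

HONEST FRAMING. Part of the Lean index of the computation cell `pub-hsemireg` (seat p10 gen 35, Sunday typer «UNIFORM-IN-n»).
LINEAR ALGEBRA OF BEZOUTIAN MATRICES AND REAL POLYNOMIALS ONLY (Mathlib's `sigPos` ∕ `sigNeg` and `Filter.atTop` asymptotics of real polynomials; PROVED Literature `SturmTheorem` (`signVar`, `chainEval`,
`chainVar`, `signedRemSeq`, `signedRemLen`), `CauchyIndex` (`cauchyIndex`, `signedRemVar`, Theorem 2.58 `signedRemVar_sub_eq_cauchyIndex`), `TarskiQuery` — IMPORTED): no variety, no cohomology theory, no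
sheaf, no Ext group and no semiregularity map is constructed here; nothing here says that HC / HC_CM / HC_AV holds; no Literature fact (unproved `Prop`) is declared or used.  Custodian versions as in
`WedgeHankelSiegelIdeal` (1/3).
SOURCE OF THE ARGUMENT (cited; held text read, `book:basu2006-algorithms-real-algebraic-geometry` pp. 326–328): BPR **Theorem 9.4** «`Sign(Bez(P,Q)) = Ind(Q/P)`» and its proof by Lemma 9.7 and Lemma 4.34 ∕ 4.35
(the Cauchy index along Euclid's algorithm); here the last identification is made through the tree's **Theorem 2.58** instead: N149's sum `Σ_{i<L} [deg S_i − deg S_{i+1} odd]·sign(lc S_i lc S_{i+1})` is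
computed to be `Var(SRemS; a) − Var(SRemS; b)` for `a` below and `b` above every real root of every `S_i` (signs at `±∞` are the signs of the leading coefficients, times `(−1)^{deg}` at `−∞`), and
Theorem 2.58 turns that into `Ind(Q/P; a, b)`.
DEDUP DISCLOSURE (`rg` of the whole tree + Mathlib, 2026-09-01): the tree has `Var(SRemS) − Var = Ind` (Literature `CauchyIndex`, Thm 2.58) and `TaQ = Ind(P′Q/P)` (`TarskiQuery`); N129 ∕ N148 equate HANKEL
signatures with `TaQ` ∕ `Ind` for Hermite numerators ∕ separable `P`; no file equates the signature of a BEZOUTIAN (or of `H(a/P)` for arbitrary `P`) with `cauchyIndex` — that is this file.  Literature's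
lemmas on `signVar` ∕ `chainEval` are PRIVATE; the zero-free evaluation formula below is a new public statement.  7 names: 0 hits tree-wide.

WHAT IS IN THE TREE (or staged ahead).  N149: **`sign_bezoutian_eq_sum_signedRemSeq`**, `signedRemSeq_signedRemLen_succ`, `signedRemSeq_succ_ne_zero_of_lt`, `signedRemLen_eq_zero_iff`, `signedRemSeq_shift`-type bookkeeping;
Literature `SturmTheorem`: `signVar`, `signVarAux`, `chainEval`, `chainVar` (public defs); `CauchyIndex`: `signedRemVar` (`= chainVar (signedRemSeq P Q) (signedRemLen P Q)`), `cauchyIndex`,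
**`signedRemVar_sub_eq_cauchyIndex`** (Thm 2.58).  Mathlib: `Polynomial.tendsto_atTop_of_leadingCoeff_nonneg ∕ tendsto_atBot_of_leadingCoeff_nonpos`, `Filter.eventually_gt_atTop`, `Filter.Eventually.exists`,
`Polynomial.leadingCoeff_comp`, `Polynomial.natDegree_comp`, `Polynomial.eval_comp`.
THIS FILE (namespace `Summit.Ventures.HSemireg.Wedge.HankelOuter` continued; CHAINED on N149 (+ Literature `TarskiQuery`, tree); 0 definitions):
* §762 SIGNS AT INFINITY: `eventually_atTop_eval_mul_leadingCoeff_pos` (`f ≠ 0 ⇒ f(x)·lc f > 0` for `x ≫ 0`), `eventually_atBot_eval_mul_leadingCoeff_mul_pos` (`f(x)·lc f·(−1)^{deg f} > 0` for `x ≪ 0`),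
  `mul_neg_iff_of_mul_pos_of_mul_pos` (bookkeeping).
* §763 ZERO-FREE SIGN VARIATIONS: **`signVar_chainEval_eq_sum_ite`** (`Var(S_j(x), …, S_{j+n}(x)) = Σ_{i<n} [S_{j+i}(x) S_{j+i+1}(x) < 0]` when no `S_{j+i}(x)` vanishes).
* §764 THE THEOREM: `sum_signedRemSeq_eq_signedRemVar_sub` (N149's sum `= Var(SRemS; a) − Var(SRemS; b)` for `a`, `b` beyond the real roots of all `S_i`; `Q = 0 ∨ deg Q < deg P`),
  **`sign_bezoutian_eq_cauchyIndex`** (`Sign B(Q, P) = cauchyIndex P Q lo hi` for `P ≠ 0`, `Q = 0 ∨ deg Q < deg P`, real roots of `P` in `(lo, hi)`), `sign_bezoutian_eq_cauchyIndex_mod` (any `Q`: `Sign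
  B(Rem(Q,P), P) = Ind(Q/P)`, Remark 2.55 (b)).
CAVEATS.  `ℝ` only; BPR's `Bez(P,Q)` is Literature's `bezoutian (natDegree P) Q P`; the Hankel reading `Sign H_{p−1}(Q/P) = Ind(Q/P)` for MONIC `P` follows with N141's `sigPos/sigNeg_bezoutian_eq` (not restated
here, to keep this file's valve at N149); the rank half is N141 ∕ N149.
Nothing Ext-side.  New names only.
-/

open Module Polynomial Filter
open scoped Matrix Polynomial Topology

namespace Summit.Ventures.HSemireg.Wedge.HankelOuter

open Summit.Ventures.HSemireg.Wedge Summit.Ventures.HSemireg.Wedge.Hankel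
open Literature.LinearAlgebra.Matrix.Bezoutian (bezoutian)
open Literature.Algebra.Polynomial (signVar signVarAux chainEval chainVar signedRemSeq signedRemLen signedRemVar cauchyIndex)

/-! ## §762. Signs of a real polynomial at `±∞` -/

/-- **`f(x)·lc(f) > 0` for all large `x`** (`f ≠ 0`). [this file, §762] -/
theorem eventually_atTop_eval_mul_leadingCoeff_pos {f : ℝ[X]} (hf : f ≠ 0) : ∀ᶠ x in atTop, 0 < f.eval x * f.leadingCoeff := by
  have hlc : f.leadingCoeff ≠ 0 := leadingCoeff_ne_zero.2 hf
  by_cases hd : f.degree ≤ 0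
  · -- constant polynomial
    have hc : f = C (f.coeff 0) := eq_C_of_degree_le_zero hd
    refine Filter.Eventually.of_forall fun x => ?_
    have hl : f.leadingCoeff = f.coeff 0 := by rw [hc, leadingCoeff_C, coeff_C_zero]
    rw [hl, hc, eval_C, coeff_C_zero]
    rw [hl] at hlc
    exact mul_self_pos.2 hlc
  · have hdeg : 0 < f.degree := lt_of_not_ge hd
    rcases hlc.lt_or_gt with hneg | hpos
    · have h := (f.tendsto_atBot_of_leadingCoeff_nonpos hdeg hneg.le).eventually (eventually_lt_atBot 0)
      exact h.mono fun x hx => mul_pos_of_neg_of_neg hx hneg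
    · have h := (f.tendsto_atTop_of_leadingCoeff_nonneg hdeg hpos.le).eventually (eventually_gt_atTop 0)
      exact h.mono fun x hx => mul_pos hx hpos

/-- **`f(x)·lc(f)·(−1)^{deg f} > 0` for all very negative `x`** (`f ≠ 0`; apply the previous statement to `f(−X)`, whose leading coefficient is `(−1)^{deg f} lc f`). [this file, §762] -/
theorem eventually_atBot_eval_mul_leadingCoeff_mul_pos {f : ℝ[X]} (hf : f ≠ 0) : ∀ᶠ x in atBot, 0 < f.eval x * f.leadingCoeff * (-1) ^ f.natDegree := by
  set g : ℝ[X] := f.comp (-Polynomial.X) with hg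
  have hnd : (-Polynomial.X : ℝ[X]).natDegree = 1 := by rw [natDegree_neg, natDegree_X]
  have hlcX : (-Polynomial.X : ℝ[X]).leadingCoeff = -1 := by rw [leadingCoeff_neg, leadingCoeff_X]
  have hglc : g.leadingCoeff = f.leadingCoeff * (-1) ^ f.natDegree := by
    rw [hg, leadingCoeff_comp (by rw [hnd]; exact one_ne_zero), hlcX]
  have hg0 : g ≠ 0 := by
    intro h
    have := congrArg leadingCoeff h
    rw [hglc, leadingCoeff_zero] at this
    exact (mul_ne_zero (leadingCoeff_ne_zero.2 hf) (pow_ne_zero _ (neg_ne_zero.2 one_ne_zero))) this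
  have hev := eventually_atTop_eval_mul_leadingCoeff_pos hg0
  have hev' : ∀ᶠ x in atBot, 0 < g.eval (-x) * g.leadingCoeff := tendsto_neg_atBot_atTop.eventually hev
  refine hev'.mono fun x hx => ?_
  rw [hg, eval_comp, eval_neg, eval_X, neg_neg, ← hg, hglc, ← mul_assoc] at hx
  exact hx

/-- Two pairs with pairwise equal signs have products of the same sign: `aa′ > 0`, `bb′ > 0 ⇒ (ab < 0 ⟺ a′b′ < 0)`. [bookkeeping] -/
theorem mul_neg_iff_of_mul_pos_of_mul_pos {a a' b b' : ℝ} (ha : 0 < a * a') (hb : 0 < b * b') : a * b < 0 ↔ a' * b' < 0 := by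
  have h : 0 < (a * b) * (a' * b') := by rw [show (a * b) * (a' * b') = (a * a') * (b * b') by ring]; exact mul_pos ha hb
  rcases pos_and_pos_or_neg_and_neg_of_mul_pos h with ⟨h1, h2⟩ | ⟨h1, h2⟩
  · exact ⟨fun h' => absurd h1 (not_lt.2 h'.le), fun h' => absurd h2 (not_lt.2 h'.le)⟩
  · exact ⟨fun _ => h2, fun _ => h1⟩

/-! ## §763. Sign variations of a chain with no zero at the point -/

/-- **`Var(S_j(x), S_{j+1}(x), …, S_{j+n}(x)) = Σ_{i<n} [S_{j+i}(x)·S_{j+i+1}(x) < 0]` when none of the `S_{j+i}(x)` (`i ≤ n`) vanishes** (Notation 2.32 without zeros to drop; Literature's recursion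
lemmas are private, this closed form is new). [this file, §763] -/
theorem signVar_chainEval_eq_sum_ite (S : ℕ → ℝ[X]) (x : ℝ) : ∀ (n j : ℕ), (∀ i ≤ n, (S (j + i)).eval x ≠ 0) →
    signVar (chainEval S x j (n + 1)) = ∑ i ∈ Finset.range n, (if (S (j + i)).eval x * (S (j + i + 1)).eval x < 0 then 1 else 0)
  | 0, j, h => by
    have h0 : (S j).eval x ≠ 0 := by simpa using h 0 le_rfl
    show signVar [(S j).eval x] = _
    rw [Finset.sum_range_zero]
    simp [signVar, signVarAux, h0]
  | n + 1, j, h => by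
    have h0 : (S j).eval x ≠ 0 := by simpa using h 0 (Nat.zero_le _)
    have h1 : (S (j + 1)).eval x ≠ 0 := h 1 (by omega)
    have ih := signVar_chainEval_eq_sum_ite S x n (j + 1) fun i hi => by rw [add_assoc, add_comm 1 i, ← add_assoc]; exact h (i + 1) (by omega)
    show signVar ((S j).eval x :: (S (j + 1)).eval x :: chainEval S x (j + 1 + 1) n) = _
    have hrec : signVar ((S j).eval x :: (S (j + 1)).eval x :: chainEval S x (j + 1 + 1) n)
        = (if (S j).eval x * (S (j + 1)).eval x < 0 then 1 else 0) + signVar ((S (j + 1)).eval x :: chainEval S x (j + 1 + 1) n) := by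
      simp [signVar, signVarAux, h0, h1]
    rw [hrec, show ((S (j + 1)).eval x :: chainEval S x (j + 1 + 1) n) = chainEval S x (j + 1) (n + 1) from rfl, ih, Finset.sum_range_succ' _ n, add_comm]
    congr 1
    refine Finset.sum_congr rfl fun i _ => ?_
    rw [show j + 1 + i = j + (i + 1) by omega, show j + (i + 1) + 1 = j + (i + 1 + 1) by omega]

/-! ## §764. BPR Theorem 9.4 (2): the signature of the Bezoutian is the Cauchy index -/

/-- **N149's odd-degree-drop sum is `Var(SRemS(P,Q); a) − Var(SRemS(P,Q); b)` for `a` below and `b` above every real root of every `S_i` (`i ≤ L`)**, precisely: whenever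
`S_i(b)·lc S_i > 0` and `S_i(a)·lc S_i·(−1)^{deg S_i} > 0` for all `i ≤ L` (`P ≠ 0`, `Q = 0 ∨ deg Q < deg P`, so that degrees drop strictly along the sequence). [this file, §764] -/
theorem sum_signedRemSeq_eq_signedRemVar_sub (P Q : ℝ[X]) (hPQ : Q = 0 ∨ Q.natDegree < P.natDegree) {a b : ℝ}
    (ha : ∀ i ≤ signedRemLen P Q, 0 < (signedRemSeq P Q i).eval a * (signedRemSeq P Q i).leadingCoeff * (-1) ^ (signedRemSeq P Q i).natDegree)
    (hb : ∀ i ≤ signedRemLen P Q, 0 < (signedRemSeq P Q i).eval b * (signedRemSeq P Q i).leadingCoeff) :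
    ∑ i ∈ Finset.range (signedRemLen P Q),
        (if Odd ((signedRemSeq P Q i).natDegree - (signedRemSeq P Q (i + 1)).natDegree) then (SignType.sign ((signedRemSeq P Q i).leadingCoeff * (signedRemSeq P Q (i + 1)).leadingCoeff) : ℤ) else 0)
      = (signedRemVar P Q a : ℤ) - signedRemVar P Q b := by
  set S := signedRemSeq P Q with hS
  set L := signedRemLen P Q with hL
  have ha0 : ∀ i ≤ L, (S (0 + i)).eval a ≠ 0 := fun i hi h0 => by have := ha i hi; rw [zero_add] at h0; rw [h0, zero_mul, zero_mul] at this; exact lt_irrefl _ this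
  have hb0 : ∀ i ≤ L, (S (0 + i)).eval b ≠ 0 := fun i hi h0 => by have := hb i hi; rw [zero_add] at h0; rw [h0, zero_mul] at this; exact lt_irrefl _ this
  have hVa : signedRemVar P Q a = ∑ i ∈ Finset.range L, (if (S i).eval a * (S (i + 1)).eval a < 0 then 1 else 0) := by
    show chainVar S L a = _
    rw [chainVar, signVar_chainEval_eq_sum_ite S a L 0 ha0]
    simp only [zero_add]
  have hVb : signedRemVar P Q b = ∑ i ∈ Finset.range L, (if (S i).eval b * (S (i + 1)).eval b < 0 then 1 else 0) := by
    show chainVar S L b = _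
    rw [chainVar, signVar_chainEval_eq_sum_ite S b L 0 hb0]
    simp only [zero_add]
  rw [hVa, hVb, Nat.cast_sum, Nat.cast_sum, ← Finset.sum_sub_distrib]
  refine Finset.sum_congr rfl fun i hi => ?_
  have hiL : i < L := Finset.mem_range.1 hi
  -- degrees drop strictly: `deg S_{i+1} < deg S_i` (for `i = 0` by hypothesis, for `i ≥ 1` as a remainder)
  have hdrop : (S (i + 1)).natDegree < (S i).natDegree ∨ S (i + 1) = 0 := by
    rcases i with _ | i
    · rcases hPQ with h | h
      · exact Or.inr h
      · exact Or.inl h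
    · by_cases h0 : S (i + 1 + 1) = 0
      · exact Or.inr h0
      · left
        have hne : S (i + 1) ≠ 0 := signedRemSeq_succ_ne_zero_of_lt P Q (by omega)
        have : (S (i + 1 + 1)).degree < (S (i + 1)).degree := by
          show (-(S i % S (i + 1))).degree < (S (i + 1)).degree
          rw [degree_neg]; exact degree_mod_lt _ hne
        exact natDegree_lt_natDegree h0 this
  have hSi1 : S (i + 1) ≠ 0 := signedRemSeq_succ_ne_zero_of_lt P Q hiL
  have hlt : (S (i + 1)).natDegree < (S i).natDegree := hdrop.resolve_right hSi1
  set l : ℝ := (S i).leadingCoeff * (S (i + 1)).leadingCoeff with hl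
  have hl0 : l ≠ 0 := mul_ne_zero (leadingCoeff_ne_zero.2 fun h => by rw [h, natDegree_zero] at hlt; exact Nat.not_lt_zero _ hlt) (leadingCoeff_ne_zero.2 hSi1)
  -- at `b`: variation iff `l < 0`
  have hvb : (S i).eval b * (S (i + 1)).eval b < 0 ↔ l < 0 :=
    mul_neg_iff_of_mul_pos_of_mul_pos (hb i hiL.le) (hb (i + 1) hiL)
  -- at `a`: variation iff `l · (−1)^{d_i + d_{i+1}} < 0`
  have hva : (S i).eval a * (S (i + 1)).eval a < 0 ↔ l * (-1) ^ ((S i).natDegree + (S (i + 1)).natDegree) < 0 := by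
    have h := mul_neg_iff_of_mul_pos_of_mul_pos (a := (S i).eval a) (a' := (S i).leadingCoeff * (-1) ^ (S i).natDegree) (b := (S (i + 1)).eval a)
      (b' := (S (i + 1)).leadingCoeff * (-1) ^ (S (i + 1)).natDegree) (by rw [← mul_assoc]; exact ha i hiL.le) (by rw [← mul_assoc]; exact ha (i + 1) hiL)
    rw [h, show (S i).leadingCoeff * (-1) ^ (S i).natDegree * ((S (i + 1)).leadingCoeff * (-1) ^ (S (i + 1)).natDegree) = l * (-1) ^ ((S i).natDegree + (S (i + 1)).natDegree) by
      rw [pow_add, hl]; ring]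
  have hpar : Odd ((S i).natDegree - (S (i + 1)).natDegree) ↔ Odd ((S i).natDegree + (S (i + 1)).natDegree) := by
    rw [Nat.odd_sub hlt.le, Nat.odd_add]
  simp only [Nat.cast_ite, Nat.cast_one, Nat.cast_zero]
  by_cases hodd : Odd ((S i).natDegree - (S (i + 1)).natDegree)
  · have hsgn : ((-1 : ℝ)) ^ ((S i).natDegree + (S (i + 1)).natDegree) = -1 := (hpar.1 hodd).neg_one_pow
    have hva' : (S i).eval a * (S (i + 1)).eval a < 0 ↔ 0 < l := by rw [hsgn, mul_neg_one, neg_lt_zero] at hva; exact hva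
    rw [if_pos hodd]
    rcases hl0.lt_or_gt with h | h
    · rw [if_neg fun h' => (not_lt.2 h.le) (hva'.1 h'), if_pos (hvb.2 h), sign_neg h]; simp
    · rw [if_pos (hva'.2 h), if_neg fun h' => (not_lt.2 h.le) (hvb.1 h'), sign_pos h]; simp
  · have heven : Even ((S i).natDegree + (S (i + 1)).natDegree) := Nat.not_odd_iff_even.1 fun h => hodd (hpar.2 h)
    have hsgn : ((-1 : ℝ)) ^ ((S i).natDegree + (S (i + 1)).natDegree) = 1 := heven.neg_one_pow
    have hva' : (S i).eval a * (S (i + 1)).eval a < 0 ↔ l < 0 := by rw [hsgn, mul_one] at hva; exact hva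
    rw [if_neg hodd]
    by_cases h : l < 0
    · rw [if_pos (hva'.2 h), if_pos (hvb.2 h)]; simp
    · rw [if_neg fun h' => h (hva'.1 h'), if_neg fun h' => h (hvb.1 h')]; simp

/-- **BPR THEOREM 9.4 (2) over `ℝ`: `Sign Bez(P, Q) = Ind(Q/P)`** — for `P ≠ 0`, `Q = 0 ∨ deg Q < deg P`, and any window `(lo, hi)` containing the real roots of `P`:
`sigPos B(Q,P) − sigNeg B(Q,P) = cauchyIndex P Q lo hi` (N149's sum, read at `±∞` by §762–§764, equals `Var(SRemS; a) − Var(SRemS; b)`, which is `Ind(Q/P; a, b)` by the tree's Theorem 2.58).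
[this file, §764] -/
theorem sign_bezoutian_eq_cauchyIndex (P Q : ℝ[X]) (hP : P ≠ 0) (hPQ : Q = 0 ∨ Q.natDegree < P.natDegree) {lo hi : ℝ} (hroots : ∀ x ∈ P.roots, lo < x ∧ x < hi) :
    (sigPos (bezoutian P.natDegree Q P).toQuadraticForm' : ℤ) - sigNeg (bezoutian P.natDegree Q P).toQuadraticForm' = cauchyIndex P Q lo hi := by
  classical
  set S := signedRemSeq P Q with hS
  set L := signedRemLen P Q with hL
  have hS0 : ∀ i ≤ L, S i ≠ 0 := by
    intro i hi
    rcases i with _ | i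
    · exact hP
    · exact signedRemSeq_succ_ne_zero_of_lt P Q (by omega)
  -- points `a ≤ lo` and `b ≥ hi` beyond every real root of every `S_i`
  have hevb : ∀ᶠ x in atTop, ∀ i ∈ Finset.range (L + 1), 0 < (S i).eval x * (S i).leadingCoeff :=
    (Finset.eventually_all (Finset.range (L + 1))).2 fun i hi => eventually_atTop_eval_mul_leadingCoeff_pos (hS0 i (Nat.le_of_lt_succ (Finset.mem_range.1 hi)))
  have heva : ∀ᶠ x in atBot, ∀ i ∈ Finset.range (L + 1), 0 < (S i).eval x * (S i).leadingCoeff * (-1) ^ (S i).natDegree :=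
    (Finset.eventually_all (Finset.range (L + 1))).2 fun i hi => eventually_atBot_eval_mul_leadingCoeff_mul_pos (hS0 i (Nat.le_of_lt_succ (Finset.mem_range.1 hi)))
  obtain ⟨a, ha, halo⟩ := (heva.and (eventually_le_atBot lo)).exists
  obtain ⟨b, hb, hbhi⟩ := (hevb.and (eventually_ge_atTop (max hi a))).exists
  have hb' : ∀ i ≤ L, 0 < (S i).eval b * (S i).leadingCoeff := fun i hi => hb i (Finset.mem_range.2 (Nat.lt_succ_of_le hi))
  have ha' : ∀ i ≤ L, 0 < (S i).eval a * (S i).leadingCoeff * (-1) ^ (S i).natDegree := fun i hi => ha i (Finset.mem_range.2 (Nat.lt_succ_of_le hi))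
  have hPa : P.eval a ≠ 0 := fun h => by have := ha' 0 (Nat.zero_le _); rw [show S 0 = P from rfl, h, zero_mul, zero_mul] at this; exact lt_irrefl _ this
  have hPb : P.eval b ≠ 0 := fun h => by have := hb' 0 (Nat.zero_le _); rw [show S 0 = P from rfl, h, zero_mul] at this; exact lt_irrefl _ this
  have hab : a ≤ b := (le_max_right hi a).trans hbhi
  have hhib : hi ≤ b := (le_max_left hi a).trans hbhi
  rw [sign_bezoutian_eq_sum_signedRemSeq L P Q rfl hPQ, sum_signedRemSeq_eq_signedRemVar_sub P Q hPQ ha' hb',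
    Literature.Algebra.Polynomial.signedRemVar_sub_eq_cauchyIndex P Q hP hab hPa hPb]
  unfold Literature.Algebra.Polynomial.cauchyIndex
  rw [Finset.filter_true_of_mem fun x hx => ?_, Finset.filter_true_of_mem fun x hx => hroots x (Multiset.mem_toFinset.1 hx)]
  have h := hroots x (Multiset.mem_toFinset.1 hx)
  exact ⟨lt_of_le_of_lt halo h.1, lt_of_lt_of_le h.2 hhib⟩

/-- **… for ANY `Q`: `Sign Bez(P, Rem(Q, P)) = Ind(Q/P)`** (`P ≠ 0`, real roots of `P` in `(lo, hi)`; Remark 2.55 (b) `Ind(Q/P) = Ind(Rem(Q,P)/P)`, Literature `cauchyIndex_mod`). [this file, §764] -/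
theorem sign_bezoutian_eq_cauchyIndex_mod (P Q : ℝ[X]) (hP : P ≠ 0) {lo hi : ℝ} (hroots : ∀ x ∈ P.roots, lo < x ∧ x < hi) :
    (sigPos (bezoutian P.natDegree (Q % P) P).toQuadraticForm' : ℤ) - sigNeg (bezoutian P.natDegree (Q % P) P).toQuadraticForm' = cauchyIndex P Q lo hi := by
  have hQ : Q % P = 0 ∨ (Q % P).natDegree < P.natDegree := by
    by_cases h0 : Q % P = 0
    · exact Or.inl h0
    · exact Or.inr (natDegree_lt_natDegree h0 (degree_mod_lt Q hP))
  rw [sign_bezoutian_eq_cauchyIndex P (Q % P) hP hQ hroots, Literature.Algebra.Polynomial.cauchyIndex_mod]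

end Summit.Ventures.HSemireg.Wedge.HankelOuter
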